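import Mathlib
import Summits.QuantumFields.BalabanUV.Beta.AnalyticWalkSum216RowConstrained

/-!
# [Balaban1985BackgroundPropagators] (3.186) p. 432 ∕ p. 422 — THE DICTIONARY OF THE CONSTRAINED LAYER DISCHARGED:
# how the RECTANGULAR constraint `Q̃ : μ × Y` sits inside the SQUARE-sandwich convention of the row-D4 chain — the
# coordinate embedding of the coarse lattice into the fine index type makes `hdict` of
# `AnalyticWalkSum216RowConstrained.termSum_constrainedΩ_flucCov` a THEOREM, so interface item (I3) of the NODE A chain
# is instance data only (cell topic `Summits/QuantumFields/BalabanUV/Beta`; row-D4 NODE A.4 leaf A.4.5, abstract form)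

HONEST FRAMING (cell rule).  Discharging `BetaPertH` makes Bałaban's UV stability UNCONDITIONAL — a real constructive-QFT
result; NOT the continuum limit, NOT the Clay problem.  This module discharges NOTHING of `BetaPertH`.  [folklore]
finite-dimensional block algebra, kernel-checked.  The sibling `AnalyticWalkSum216RowConstrained` (gen 38, p218683) proved
the constrained layer G₂ → G̃₂ of the abstract NODE A chain with ONE displayed non-instance hypothesis, the DICTIONARY
`hdict : P·(1 + Σ_ω Kp_ω)⁻¹·Q = Q̃ᵀ·(Q̃𝒢Q̃ᵀ)⁻¹·Q̃` (census `BETA/REMAINDER-BETA.md` §10.26, interface item (I3) «… + hdict»).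
Here it is DISCHARGED: for any `E : Matrix μ Y` with `E·Eᵀ = 1` (e.g. the coordinate matrix `embM e` of an injection
`e : μ ↪ Y` of the coarse sites into the fine index type — block representatives), the SQUARE LIFT
`liftSq E C := Eᵀ·C·E + (1 − EᵀE)` of a coarse operator `C : Matrix μ μ` is multiplicative and unital, `E·(liftSq E C)⁻¹·Eᵀ
= C⁻¹` UNCONDITIONALLY, and `1 + Eᵀ(C − 1)E = liftSq E C`; hence with `P := Q̃ᵀE`, `Q := EᵀQ̃` and coarse pieces summing
to `Eᵀ(Q̃𝒢Q̃ᵀ − 1)E` the dictionary HOLDS (`dict`, `hdict_of_embedding`), and THEOREM B's identification is restated with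
`hdict` replaced by the INSTANCE statement `Σ_ω Kp_ω = Eᵀ(Q̃𝒢Q̃ᵀ − 1)E` (`termSum_constrainedΩ_flucCov_embed`).  The WRS
budgets of the two sandwich factors reduce to two displayed localisation sums of `Q̃` itself (`wrs_transpose_mul_embM`,
`wrs_embM_transpose_mul`).  After this file interface item (I3) reads: Ω-data for the coarse pieces of
`Eᵀ(Q̃G₂Q̃ᵀ − 1)E` + local inverses (positivity, G-B9-15) — nothing else.  Nothing of Bałaban's operators is
instantiated; NO class change on any GAPS row; readiness width 0 unchanged; NOT summit progress.  Unit
`b2b-balaban-beta-an4-g39` (owner lineage of `BINDER-OWNERS.md` row D4); `GAPS.md` C-an4-101.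

CITATION HEADER (lean-in-tree rule).  [13] = T. Bałaban, *Propagators for lattice gauge theories in a background field*,
Commun. Math. Phys. **99**, 389–434 (1985) [Balaban1985BackgroundPropagators], p. 432 (3.186) «G̃₂ = G₂ −
G₂Q̃*(Q̃G₂Q̃*)⁻¹Q̃G₂» and p. 422 «The operators (QGQ*)⁻¹, or (QG₁Q*)⁻¹, can be analyzed in the same way as the operator
(Q′G′²Q′*)⁻¹» (quoted in full in the sibling's header; renders read there).  LOCATORS only; nothing printed is asserted.

WHAT IS CERTIFIED HERE (kernel, sorry-free; [folklore]).
§1 `embM e` (coordinate matrix of `e : μ → Y`), `embM_mul_transpose` (`E·Eᵀ = 1` for injective `e`), `liftSq`,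
   `liftSq_one`, `liftSq_mul`, `compress_liftSq` (`E·liftSq C·Eᵀ = C`), `isUnit_det_of_liftSq`,
   `compress_liftSq_inv` (`E·(liftSq C)⁻¹·Eᵀ = C⁻¹`, no invertibility hypothesis), `liftSq_inv` (for nonsingular `C`),
   `one_add_conj_sub_one` (`1 + Eᵀ(C − 1)E = liftSq E C`).
§2 THE DICTIONARY: `dict` (`(Q̃ᵀE)·(1 + Eᵀ(C − 1)E)⁻¹·(EᵀQ̃) = Q̃ᵀC⁻¹Q̃`) and `hdict_of_embedding` (the letters of the
   sibling: `Σ_ωKp_ω = Eᵀ(Q̃𝒢Q̃ᵀ − 1)E ⟹ hdict` with `P := Q̃ᵀE`, `Q := EᵀQ̃`).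
§3 `termSum_constrainedΩ_flucCov_embed`: THEOREM B's (3.186) identification with `hdict` REPLACED by `E·Eᵀ = 1` and the
   instance statement on `Σ_ωKp_ω` (all other binders the sibling's, verbatim).
§4 `wrs_transpose_mul_embM`, `wrs_embM_transpose_mul`: the sandwich factors' WRS budgets from two localisation sums of `Q̃`.
§5 Non-vacuity (two fine sites, one coarse site).
NOT CLAIMED.  Any expansion of Bałaban's (Q̃G₂Q̃*)⁻¹; positivity ∕ existence of the coarse local inverses (G-B9-15);
k-uniformity (NODE O.2); that Bałaban's block representatives are the intended `e` (a convention of the instance).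
NOT summit progress.
PRIOR ART IN THE TREE (searched 2026-08-20: `lean search liftSq|embM|toBlocks₁₁_border|fromBlocks_one`): the sibling
(THEOREM A∕B); b09 `B9SectECov` (bordered-inverse blocks `toBlocks₁₁_border_conj` — rectangular borders of `kkt`, a
different embedding); an4 `RelInvTransport.lift_conj_bordered` (row D1, KKT lift — not this identity); Mathlib
`Matrix.fromBlocks` (would need `Y ≃ μ ⊕ ν`; avoided: the chain's index type stays `Y`).
-/

namespace Summit.QuantumFields.BalabanUV.Beta.AnalyticWalkSum216RowConstrainedDict

open Metric Set
open scoped Matrix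
open Literature.MathematicalPhysics.QuantumFieldTheory.Balaban1983to89
open B13PerturbativeStep (WRS WeightHyp wrs)
open Literature.MathematicalPhysics.QuantumFieldTheory.Balaban1983to89.Beta.CompositionSingular (flucCov)
open Summit.QuantumFields.BalabanUV.Beta.AnalyticWalkSum216 (termSum majSum)
open Summit.QuantumFields.BalabanUV.Beta.AnalyticWalkSum216Recomb (recombTerm recombMaj)
open Summit.QuantumFields.BalabanUV.Beta.AnalyticWalkSum216RowResolvent
open Summit.QuantumFields.BalabanUV.Beta.AnalyticWalkSum216RowConstrained
open Summit.QuantumFields.BalabanUV.Beta.UnitLatticeWalkInversion (Hd Pj Ptot)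
open Summit.QuantumFields.BalabanUV.Beta.UnitLatticeOmegaTerms
open Summit.QuantumFields.BalabanUV.Beta.UnitLatticeOmegaTube (listLen listLen_nonneg decΩ)
open Summit.QuantumFields.BalabanUV.Beta.UnitLatticeOmegaPaths
open Summit.QuantumFields.BalabanUV.Beta.UnitLatticeOmegaRowData

noncomputable section

variable {μ Y : Type*} [Fintype μ] [Fintype Y] [DecidableEq μ] [DecidableEq Y]

/-! ## §1 The coordinate embedding and the square lift of a coarse operator -/

/-- The COORDINATE MATRIX of a map `e : μ → Y` (coarse sites ↦ block representatives): `E a y = [e a = y]`. [folklore] -/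
def embM (e : μ → Y) : Matrix μ Y ℂ := Matrix.of fun a y => if e a = y then 1 else 0

omit [Fintype μ] [Fintype Y] [DecidableEq μ] in
/-- Entries of the coordinate matrix. [folklore] -/
theorem embM_apply (e : μ → Y) (a : μ) (y : Y) : embM e a y = if e a = y then 1 else 0 := rfl

omit [Fintype μ] in
/-- **`E·Eᵀ = 1`** for the coordinate matrix of an INJECTIVE `e`. [folklore] -/
theorem embM_mul_transpose (e : μ → Y) (he : Function.Injective e) : embM e * (embM e)ᵀ = 1 := by
  ext a b
  simp only [Matrix.mul_apply, Matrix.transpose_apply, embM_apply, mul_ite, mul_one, mul_zero]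
  rw [Finset.sum_eq_single (e a) (fun y _ hy => by rw [if_neg (Ne.symm hy)]; split_ifs <;> rfl)
    (fun h => (h (Finset.mem_univ _)).elim)]
  simp only [if_true]
  by_cases hab : a = b
  · subst hab; simp
  · rw [Matrix.one_apply_ne hab, if_neg (fun h => hab (he h.symm))]

omit [DecidableEq Y] in
/-- `E·(Eᵀ·X) = X` when `E·Eᵀ = 1`. [folklore] -/
theorem mul_transpose_mul_cancel {n : Type*} {E : Matrix μ Y ℂ} (hE : E * Eᵀ = 1) (X : Matrix μ n ℂ) :
    E * (Eᵀ * X) = X := by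
  rw [← Matrix.mul_assoc, hE, Matrix.one_mul]

/-- The SQUARE LIFT of a coarse operator `C : Matrix μ μ` to the fine index type along `E`: `Eᵀ·C·E + (1 − EᵀE)` (`C`
on the image of the coarse lattice, the identity on its complement). [folklore] -/
def liftSq (E : Matrix μ Y ℂ) (C : Matrix μ μ ℂ) : Matrix Y Y ℂ := Eᵀ * C * E + (1 - Eᵀ * E)

omit [Fintype Y] in
/-- The lift is unital. [folklore] -/
theorem liftSq_one (E : Matrix μ Y ℂ) : liftSq E 1 = 1 := by
  simp [liftSq]

/-- **The lift is multiplicative** (`E·Eᵀ = 1`). [folklore] -/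
theorem liftSq_mul {E : Matrix μ Y ℂ} (hE : E * Eᵀ = 1) (C D : Matrix μ μ ℂ) :
    liftSq E (C * D) = liftSq E C * liftSq E D := by
  simp only [liftSq, Matrix.add_mul, Matrix.mul_add, Matrix.sub_mul, Matrix.mul_sub, Matrix.one_mul,
    Matrix.mul_one, Matrix.mul_assoc, mul_transpose_mul_cancel hE]
  abel

/-- **Compression recovers the coarse operator**: `E·(liftSq E C)·Eᵀ = C`. [folklore] -/
theorem compress_liftSq {E : Matrix μ Y ℂ} (hE : E * Eᵀ = 1) (C : Matrix μ μ ℂ) : E * liftSq E C * Eᵀ = C := by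
  simp only [liftSq, Matrix.add_mul, Matrix.mul_add, Matrix.sub_mul, Matrix.mul_sub,
    Matrix.mul_one, Matrix.mul_assoc, mul_transpose_mul_cancel hE, hE]
  abel

/-- **A nonsingular lift has a nonsingular coarse operator**: `E·(liftSq C)⁻¹·Eᵀ` is a right inverse of `C`. [folklore] -/
theorem isUnit_det_of_liftSq {E : Matrix μ Y ℂ} (hE : E * Eᵀ = 1) {C : Matrix μ μ ℂ}
    (h : IsUnit (liftSq E C).det) : IsUnit C.det := by
  refine Matrix.isUnit_det_of_right_inverse (B := E * (liftSq E C)⁻¹ * Eᵀ) ?_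
  have h1 : liftSq E C * (liftSq E C)⁻¹ = 1 := Matrix.mul_nonsing_inv _ h
  -- `C·E = E·(liftSq C) − E·(1 − EᵀE) = E·liftSq C` since `E(1 − EᵀE) = 0`
  have h2 : C * E = E * liftSq E C := by
    simp only [liftSq, Matrix.mul_add, Matrix.mul_sub, Matrix.mul_one, Matrix.mul_assoc,
      mul_transpose_mul_cancel hE]
    abel
  calc C * (E * (liftSq E C)⁻¹ * Eᵀ) = C * E * (liftSq E C)⁻¹ * Eᵀ := by simp only [Matrix.mul_assoc]
    _ = E * (liftSq E C * (liftSq E C)⁻¹) * Eᵀ := by rw [h2]; simp only [Matrix.mul_assoc]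
    _ = 1 := by rw [h1, Matrix.mul_one, hE]

/-- **`E·(liftSq E C)⁻¹·Eᵀ = C⁻¹`, with NO invertibility hypothesis** (both sides vanish when `C` is singular). [folklore] -/
theorem compress_liftSq_inv {E : Matrix μ Y ℂ} (hE : E * Eᵀ = 1) (C : Matrix μ μ ℂ) :
    E * (liftSq E C)⁻¹ * Eᵀ = C⁻¹ := by
  by_cases hC : IsUnit C.det
  · have hinv : (liftSq E C)⁻¹ = liftSq E C⁻¹ := by
      refine Matrix.inv_eq_right_inv ?_
      rw [← liftSq_mul hE, Matrix.mul_nonsing_inv _ hC, liftSq_one]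
    rw [hinv, compress_liftSq hE]
  · have hL : ¬ IsUnit (liftSq E C).det := fun h => hC (isUnit_det_of_liftSq hE h)
    rw [Matrix.nonsing_inv_apply_not_isUnit _ hC, Matrix.nonsing_inv_apply_not_isUnit _ hL, Matrix.mul_zero,
      Matrix.zero_mul]

/-- The inverse of a lift is the lift of the inverse (nonsingular `C`). [folklore] -/
theorem liftSq_inv {E : Matrix μ Y ℂ} (hE : E * Eᵀ = 1) {C : Matrix μ μ ℂ} (hC : IsUnit C.det) :
    (liftSq E C)⁻¹ = liftSq E C⁻¹ := by
  refine Matrix.inv_eq_right_inv ?_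
  rw [← liftSq_mul hE, Matrix.mul_nonsing_inv _ hC, liftSq_one]

omit [Fintype Y] in
/-- **`1 + Eᵀ(C − 1)E = liftSq E C`** — the coarse pieces «Q̃GQ̃* − 1» embedded as fine-index matrices add up, with the
fine identity, to the square lift of `Q̃GQ̃*`. [folklore] -/
theorem one_add_conj_sub_one (E : Matrix μ Y ℂ) (C : Matrix μ μ ℂ) : 1 + Eᵀ * (C - 1) * E = liftSq E C := by
  simp only [liftSq, Matrix.mul_sub, Matrix.sub_mul, Matrix.mul_one]
  abel

/-! ## §2 The dictionary -/

/-- **THE DICTIONARY.**  `(Q̃ᵀE)·(1 + Eᵀ(C − 1)E)⁻¹·(EᵀQ̃) = Q̃ᵀ·C⁻¹·Q̃` for every `E` with `E·Eᵀ = 1`, every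
rectangular `Q̃ : Matrix μ Y` and every coarse `C` (no invertibility needed). [cite: Balaban1985BackgroundPropagators, (3.186) p.432] -/
theorem dict {E : Matrix μ Y ℂ} (hE : E * Eᵀ = 1) (Qt : Matrix μ Y ℂ) (C : Matrix μ μ ℂ) :
    Qtᵀ * E * (1 + Eᵀ * (C - 1) * E)⁻¹ * (Eᵀ * Qt) = Qtᵀ * C⁻¹ * Qt := by
  rw [one_add_conj_sub_one, ← compress_liftSq_inv hE C]
  simp only [Matrix.mul_assoc]

/-- **`hdict` OF THE SIBLING FROM THE EMBEDDING**: in the letters of `termSum_constrainedΩ_flucCov` — if the coarse pieces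
sum to `Σ_ω Kp_ω = Eᵀ(Q̃𝒢Q̃ᵀ − 1)E` then, with `P := Q̃ᵀE` and `Q := EᵀQ̃`,
`P·(1 + Σ_ωKp_ω)⁻¹·Q = Q̃ᵀ(Q̃𝒢Q̃ᵀ)⁻¹Q̃`. [cite: Balaban1985BackgroundPropagators, (3.186) p.432] -/
theorem hdict_of_embedding {Ω Ω' : Type*} [Fintype Ω] [Fintype Ω'] {E : Matrix μ Y ℂ} (hE : E * Eᵀ = 1)
    (Qt : Matrix μ Y ℂ) (G : Ω → Matrix Y Y ℂ) (Kp : Ω' → Matrix Y Y ℂ)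
    (hKtot : Ktot Kp = Eᵀ * (Qt * Ktot G * Qtᵀ - 1) * E) :
    Qtᵀ * E * (1 + Ktot Kp)⁻¹ * (Eᵀ * Qt) = Qtᵀ * (Qt * Ktot G * Qtᵀ)⁻¹ * Qt := by
  rw [hKtot]
  exact dict hE Qt _

/-! ## §3 THEOREM B's (3.186) identification without the dictionary hypothesis -/

section TheoremB

variable {κ : ℝ} {d : Y → Y → ℝ} {B Ω Ω' Δ : Type*} [Fintype B] [Fintype Ω] [Fintype Ω'] [DecidableEq Ω']
  [DecidableEq Δ]

/-- **THE (3.186) IDENTIFICATION, THEOREM B LEVEL, `hdict` DISCHARGED.**  The sibling's `termSum_constrainedΩ_flucCov`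
with the sandwich factors `P := Q̃ᵀE`, `Q := EᵀQ̃` of an embedding `E·Eᵀ = 1` and the dictionary hypothesis REPLACED by
the instance statement `Σ_ω Kp_ω = Eᵀ(Q̃𝒢Q̃ᵀ − 1)E` (the coarse pieces expand the embedded «Q̃G₂Q̃* − 1»); every other
binder is the sibling's ∕ the co-owner's VERBATIM.  At `τ ≡ 1`, `σ = 1` the constrained family sums to `flucCov K Q̃` =
G̃₂. [cite: Balaban1985BackgroundPropagators, (3.186) p.432] -/
theorem termSum_constrainedΩ_flucCov_embed [Nonempty Y] (hw : WeightHyp κ d) (hsymm : ∀ a b, d a b = d b a)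
    (G : Ω → Matrix Y Y ℂ) (DG : Ω → Finset Δ) {κ₁ ρG : ℝ} (hκ₁ : 0 < κ₁)
    (hG : ∀ i, ∑ j, (∑ ω, pieceMaj κ₁ G DG ω i j) * Real.exp (κ * d i j) ≤ ρG)
    (E : Matrix μ Y ℂ) (hE : E * Eᵀ = 1) (Qt : Matrix μ Y ℂ) {cP cQ : ℝ} (hP : WRS κ d (Qtᵀ * E) cP)
    (hQ : WRS κ d (Eᵀ * Qt) cQ) (K : Matrix Y Y ℂ) (a : ℂ) (hKa : IsUnit (K + a • (Qtᵀ * Qt)).det)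
    (hPr : IsUnit (Qt * (K + a • (Qtᵀ * Qt))⁻¹ * Qtᵀ).det) (hGsum : Ktot G = (K + a • (Qtᵀ * Qt))⁻¹)
    (Kp : Ω' → Matrix Y Y ℂ) (hKtot : Ktot Kp = Eᵀ * (Qt * Ktot G * Qtᵀ - 1) * E)
    (Dω : Ω' → Finset Y) (hKdom : ∀ ω k l, Kp ω k l ≠ 0 → k ∈ Dω ω) (near : B → Finset Ω')
    (h : B → Y → ℝ) (Eb : B → Finset Y) (L : B → Matrix Y Y ℂ) (hsupp : ∀ b y, y ∉ Eb b → h b y = 0)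
    (habs : ∀ b y, |h b y| ≤ 1) (hsum2 : ∀ y, ∑ b, h b y ^ 2 = 1) (hPL : ∀ b, Pj Eb b * L b = L b)
    (hloc : ∀ b, Pj Eb b * (1 + Knear Kp near b) * Pj Eb b * L b = Pj Eb b)
    {M N C_L K₁ Φ r D Df Rr : ℝ} (hM : 0 < M)
    (hLip : ∀ b y y', |h b y - h b y'| ≤ d y y' / M) (hN : ∀ y, ((Finset.univ.filter fun b => y ∈ Eb b).card : ℝ) ≤ N)
    (hC : 0 ≤ C_L) (hr : 0 < r) (hRD : r + D ≤ Rr) (hRf : r + Df ≤ Rr) (hDf : 0 ≤ Df) (cellOf : Y → Δ) {Pk : ℕ}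
    (hpack : ∀ a : Y, ∃ S : Finset Δ, S.card ≤ Pk ∧ ∀ z, d a z ≤ Rr → cellOf z ∈ S)
    (hdiam : ∀ b, ∀ z ∈ Eb b, ∀ z' ∈ Eb b, d z z' ≤ D) (thr : Ω' → List Y)
    (hthr : ∀ ω, ∀ z ∈ Dω ω, ∃ p ∈ thr ω, d z p ≤ Df) (cr : Ω' → ℝ) (hcr : ∀ ω, 3 * listLen d (thr ω) + 2 * Df ≤ cr ω)
    (hL : ∀ b, WRS (κ + κ₁ * (Pk / r)) d (L b) C_L)
    (hK₁ : ∀ k, ∑ ω, ∑ l, ‖Kp ω k l‖ * d k l * Real.exp ((κ + κ₁ * (Pk / r)) * d k l + κ₁ * (Pk / r) * cr ω) ≤ K₁)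
    (hΦ : ∀ k, ∑ ω, ∑ l, (∑ b, if ω ∈ near b then (0 : ℝ) else |h b l|) * ‖Kp ω k l‖
      * Real.exp ((κ + κ₁ * (Pk / r)) * d k l + κ₁ * (Pk / r) * cr ω) ≤ Φ)
    (hρ : C_L * (2 * N / M * K₁ + Φ) < 1) (Δ₀ : Δ) :
    termSum (recombTerm (decPieces G DG (fun _ => (1 : ℂ)) Δ₀)
        (sandTerm (Qtᵀ * E) (Eᵀ * Qt) (decFamilyΩ cellOf Eb Dω h Kp near L (fun _ => (1 : ℂ)) Δ₀)) 1) 1 =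
      flucCov K Qt :=
  termSum_constrainedΩ_flucCov hw hsymm G DG hκ₁ hG (Qtᵀ * E) (Eᵀ * Qt) hP hQ K Qt a hKa hPr hGsum Kp
    (hdict_of_embedding hE Qt G Kp hKtot) Dω hKdom near h Eb L hsupp habs hsum2 hPL hloc hM hLip hN hC hr hRD hRf hDf
    cellOf hpack hdiam thr hthr cr hcr hL hK₁ hΦ hρ Δ₀

end TheoremB

/-! ## §4 The sandwich factors' WRS budgets from the localisation of `Q̃` -/

section Budgets

variable {κ : ℝ} {d : Y → Y → ℝ}

omit [DecidableEq μ] in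
/-- **`WRS κ d (Q̃ᵀ·E) c_P`** from the COLUMN localisation sum of `Q̃` read at the representatives:
`Σ_a ‖Q̃ a y‖·e^{κ d(y, e a)} ≤ c_P` for every fine site `y`. [folklore] -/
theorem wrs_transpose_mul_embM (e : μ → Y) (Qt : Matrix μ Y ℂ) {cP : ℝ}
    (hcol : ∀ y, ∑ a, ‖Qt a y‖ * Real.exp (κ * d y (e a)) ≤ cP) : WRS κ d (Qtᵀ * embM e) cP := by
  intro y
  have hent : ∀ y', ‖(Qtᵀ * embM e) y y'‖ ≤ ∑ a, ‖Qt a y‖ * (if e a = y' then 1 else 0) := fun y' => by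
    rw [Matrix.mul_apply]
    refine (norm_sum_le _ _).trans (Finset.sum_le_sum fun a _ => ?_)
    rw [Matrix.transpose_apply, embM_apply]
    split_ifs <;> simp
  unfold wrs
  calc ∑ y', ‖(Qtᵀ * embM e) y y'‖ * Real.exp (κ * d y y')
      ≤ ∑ y', (∑ a, ‖Qt a y‖ * (if e a = y' then 1 else 0)) * Real.exp (κ * d y y') :=
        Finset.sum_le_sum fun y' _ => mul_le_mul_of_nonneg_right (hent y') (Real.exp_pos _).le
    _ = ∑ a, ‖Qt a y‖ * Real.exp (κ * d y (e a)) := by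
        simp_rw [Finset.sum_mul]
        rw [Finset.sum_comm]
        refine Finset.sum_congr rfl fun a _ => ?_
        rw [Finset.sum_eq_single (e a) (fun y' _ hy => by rw [if_neg (Ne.symm hy), mul_zero, zero_mul])
          (fun h => (h (Finset.mem_univ _)).elim), if_pos rfl, mul_one]
    _ ≤ cP := hcol y

omit [DecidableEq μ] in
/-- **`WRS κ d (Eᵀ·Q̃) c_Q`** from the ROW localisation sum of `Q̃`: `Σ_y ‖Q̃ a y‖·e^{κ d(e a, y)} ≤ c_Q` for every coarse
site `a` (`e` injective; rows off the image vanish). [folklore] -/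
theorem wrs_embM_transpose_mul (e : μ → Y) (he : Function.Injective e) (Qt : Matrix μ Y ℂ) {cQ : ℝ} (hcQ : 0 ≤ cQ)
    (hrow : ∀ a, ∑ y, ‖Qt a y‖ * Real.exp (κ * d (e a) y) ≤ cQ) : WRS κ d ((embM e)ᵀ * Qt) cQ := by
  intro y
  unfold wrs
  by_cases hy : ∃ a, e a = y
  · obtain ⟨a, rfl⟩ := hy
    refine le_of_eq_of_le (Finset.sum_congr rfl fun y' _ => ?_) (hrow a)
    rw [Matrix.mul_apply, Finset.sum_eq_single a (fun a' _ ha' => by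
      rw [Matrix.transpose_apply, embM_apply, if_neg (fun h => ha' (he h)), zero_mul])
      (fun h => (h (Finset.mem_univ _)).elim), Matrix.transpose_apply, embM_apply, if_pos rfl, one_mul]
  · have hy' : ∀ a, e a ≠ y := fun a h => hy ⟨a, h⟩
    refine le_of_eq_of_le (Finset.sum_eq_zero fun y' _ => ?_) hcQ
    rw [Matrix.mul_apply, Finset.sum_eq_zero fun a _ => ?_, norm_zero, zero_mul]
    rw [Matrix.transpose_apply, embM_apply, if_neg (hy' a), zero_mul]

end Budgets

/-! ## §5 Non-vacuity: two fine sites, one coarse site -/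

/-- The representative map of the two-site block: the coarse site sits at fine site `0`. [folklore] -/
def e₂ : Fin 1 → Fin 2 := fun _ => 0

/-- `E·Eᵀ = 1` for the two-site block. [folklore] -/
theorem embM_e₂ : embM e₂ * (embM e₂)ᵀ = 1 := embM_mul_transpose e₂ fun a b _ => Subsingleton.elim a b

/-- The dictionary on concrete data: the AVERAGING constraint `Q̃ = (1 1)` of the two-site block and the coarse operator
`C = (2/3)` (= `Q̃(1 + Q̃ᵀQ̃)⁻¹Q̃ᵀ`); `(Q̃ᵀE)(1 + Eᵀ(C − 1)E)⁻¹(EᵀQ̃) = Q̃ᵀC⁻¹Q̃`. [folklore] -/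
example : (!![(1 : ℂ), 1] : Matrix (Fin 1) (Fin 2) ℂ)ᵀ * embM e₂ *
      (1 + (embM e₂)ᵀ * ((!![(2 / 3 : ℂ)] : Matrix (Fin 1) (Fin 1) ℂ) - 1) * embM e₂)⁻¹ *
        ((embM e₂)ᵀ * (!![(1 : ℂ), 1] : Matrix (Fin 1) (Fin 2) ℂ)) =
    (!![(1 : ℂ), 1] : Matrix (Fin 1) (Fin 2) ℂ)ᵀ * (!![(2 / 3 : ℂ)] : Matrix (Fin 1) (Fin 1) ℂ)⁻¹ *
      (!![(1 : ℂ), 1] : Matrix (Fin 1) (Fin 2) ℂ) :=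
  dict embM_e₂ _ _

end

end Summit.QuantumFields.BalabanUV.Beta.AnalyticWalkSum216RowConstrainedDict
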